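import Literature.Probability.Percolation.CornerPercolation
import HarnessLib

/-!
# Stub `stub_negCrossing` of line `registered` (crux stmt-CriticalPhenomena-6470 `SegmentRSW`):
# point reflection does not change rectangle-crossing probabilities of the corner model `M_t`

For every `t ∈ [0, 1]` and every lattice rectangle `[0, M] × [0, N]`, the point-reflected corner
configuration `-ω` (`BondConfig.relabel (sym2Equiv (Equiv.neg _)) ω`, `ω ~ M_t = cornerPercolation t`)
crosses the rectangle left–right (resp. top–bottom) with the same probability as `ω` itself.

Proof (pure lattice symmetry, all ingredients in `CornerPercolation.lean` / `LatticeSymmetry.lean`):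
`(M_t.map (-·)).real A = M_t.real ((-·) ⁻¹' A)` (`map_measureReal_apply`); the pull-back of
`LR([0,M]×[0,N]) = C(R; L, Rt)` under the reflection is the crossing `C(R + v; Rt + v, L + v)` of the
translate by `v = (-M, -N)` between its right and its left side, because `-(R + v) = R`,
`-(Rt + v) = L`, `-(L + v) = Rt` (`preimage_relabel_openCrossing (Equiv.neg _)`); translations
preserve `M_t` (`cornerPercolation_real_openCrossing_shift`) and `C(R; Rt, L) = C(R; L, Rt)`
(symmetry of `{x ↔ y in S}`). The same with bottom/top for `TB`.
-/

noncomputable section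

namespace Summit.CriticalPhenomena.CardyFormulaZ2.Cruxes.SegmentRSW.Birth

open MeasureTheory ProbabilityTheory
open Literature.Probability.Percolation Literature.Probability.LatticeModels

/-! ### Geometry of the point reflection on rectangles -/

/-- Open crossing events are symmetric in the two target sets (reachability is symmetric). [folklore] -/
private theorem openCrossing_comm_aux {V : Type*} (S A B : Set V) :
    (openCrossing S A B : Set (BondConfig V)) = openCrossing S B A := by
  ext ω
  simp only [mem_openCrossing_iff]
  constructor
  · rintro ⟨x, hx, y, hy, h⟩
    exact ⟨y, hy, x, hx, by rw [openConnIn_comm]; exact h⟩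
  · rintro ⟨x, hx, y, hy, h⟩
    exact ⟨y, hy, x, hx, by rw [openConnIn_comm]; exact h⟩

/-- `[0, M] × [0, N]` is the point reflection of its translate by `(-M, -N)`. [folklore] -/
private theorem negEquiv_image_shift_rectangle (M N : ℕ) :
    (Equiv.neg (Site 2)) '' ((· + dualCorner M N) '' (↑(rectangle M N) : Set (Site 2))) =
      ↑(rectangle M N) := by
  ext z
  rw [mem_image_negEquiv_iff, Finset.mem_coe, mem_rectangle_iff]
  simp only [Set.image_add_right, Set.mem_preimage, Finset.mem_coe, mem_rectangle_iff, Pi.add_apply,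
    Pi.neg_apply, dualCorner_apply_zero, dualCorner_apply_one]
  omega

/-- The left side of `[0, M] × [0, N]` is the point reflection of the translated right side. [folklore] -/
private theorem negEquiv_image_shift_rightSide (M N : ℕ) :
    (Equiv.neg (Site 2)) '' ((· + dualCorner M N) '' (↑(rightSide M N) : Set (Site 2))) =
      ↑(leftSide M N) := by
  ext z
  rw [mem_image_negEquiv_iff, Finset.mem_coe, leftSide, Finset.mem_filter, mem_rectangle_iff]
  simp only [Set.image_add_right, Set.mem_preimage, Finset.mem_coe, rightSide, Finset.mem_filter,
    mem_rectangle_iff, Pi.add_apply, Pi.neg_apply, dualCorner_apply_zero, dualCorner_apply_one]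
  omega

/-- The right side of `[0, M] × [0, N]` is the point reflection of the translated left side. [folklore] -/
private theorem negEquiv_image_shift_leftSide (M N : ℕ) :
    (Equiv.neg (Site 2)) '' ((· + dualCorner M N) '' (↑(leftSide M N) : Set (Site 2))) =
      ↑(rightSide M N) := by
  ext z
  rw [mem_image_negEquiv_iff, Finset.mem_coe, rightSide, Finset.mem_filter, mem_rectangle_iff]
  simp only [Set.image_add_right, Set.mem_preimage, Finset.mem_coe, leftSide, Finset.mem_filter,
    mem_rectangle_iff, Pi.add_apply, Pi.neg_apply, dualCorner_apply_zero, dualCorner_apply_one]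
  omega

/-- The bottom side of `[0, M] × [0, N]` is the point reflection of the translated top side. [folklore] -/
private theorem negEquiv_image_shift_topSide (M N : ℕ) :
    (Equiv.neg (Site 2)) '' ((· + dualCorner M N) '' (↑(topSide M N) : Set (Site 2))) =
      ↑(bottomSide M N) := by
  ext z
  rw [mem_image_negEquiv_iff, Finset.mem_coe, bottomSide, Finset.mem_filter, mem_rectangle_iff]
  simp only [Set.image_add_right, Set.mem_preimage, Finset.mem_coe, topSide, Finset.mem_filter,
    mem_rectangle_iff, Pi.add_apply, Pi.neg_apply, dualCorner_apply_zero, dualCorner_apply_one]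
  omega

/-- The top side of `[0, M] × [0, N]` is the point reflection of the translated bottom side. [folklore] -/
private theorem negEquiv_image_shift_bottomSide (M N : ℕ) :
    (Equiv.neg (Site 2)) '' ((· + dualCorner M N) '' (↑(bottomSide M N) : Set (Site 2))) =
      ↑(topSide M N) := by
  ext z
  rw [mem_image_negEquiv_iff, Finset.mem_coe, topSide, Finset.mem_filter, mem_rectangle_iff]
  simp only [Set.image_add_right, Set.mem_preimage, Finset.mem_coe, bottomSide, Finset.mem_filter,
    mem_rectangle_iff, Pi.add_apply, Pi.neg_apply, dualCorner_apply_zero, dualCorner_apply_one]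
  omega

/-- The point reflection pulls `LR([0, M] × [0, N])` back to the right-to-left crossing of the
translate `[0, M] × [0, N] - (M, N)`. [folklore] -/
private theorem preimage_relabel_neg_lrCrossing (M N : ℕ) :
    BondConfig.relabel (sym2Equiv (Equiv.neg (Site 2))) ⁻¹' lrCrossing M N =
      openCrossing ((· + dualCorner M N) '' (↑(rectangle M N) : Set (Site 2)))
        ((· + dualCorner M N) '' (↑(rightSide M N) : Set (Site 2)))
        ((· + dualCorner M N) '' (↑(leftSide M N) : Set (Site 2))) := by
  rw [← preimage_relabel_openCrossing (Equiv.neg (Site 2)), negEquiv_image_shift_rectangle,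
    negEquiv_image_shift_rightSide, negEquiv_image_shift_leftSide]
  rfl

/-- The point reflection pulls `TB([0, M] × [0, N])` back to the top-to-bottom crossing of the
translate `[0, M] × [0, N] - (M, N)`. [folklore] -/
private theorem preimage_relabel_neg_tbCrossing (M N : ℕ) :
    BondConfig.relabel (sym2Equiv (Equiv.neg (Site 2))) ⁻¹' tbCrossing M N =
      openCrossing ((· + dualCorner M N) '' (↑(rectangle M N) : Set (Site 2)))
        ((· + dualCorner M N) '' (↑(topSide M N) : Set (Site 2)))
        ((· + dualCorner M N) '' (↑(bottomSide M N) : Set (Site 2))) := by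
  rw [← preimage_relabel_openCrossing (Equiv.neg (Site 2)), negEquiv_image_shift_rectangle,
    negEquiv_image_shift_topSide, negEquiv_image_shift_bottomSide]
  rfl

/-! ### The stub -/

/-- **Stub `stub_negCrossing` (point-reflection invariance of rectangle crossings).** Under every
corner model `M_t`, the point-reflected configuration crosses `[0, M] × [0, N]` left–right (resp.
top–bottom) with the same probability as the configuration itself: `(-·) ⁻¹' LR([0,M]×[0,N])` is
the right-to-left crossing of the translate `[0,M]×[0,N] - (M,N)` (`preimage_relabel_openCrossing
(Equiv.neg _)` read backwards), translations preserve `M_t`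
(`cornerPercolation_real_openCrossing_shift`), and open crossing events are symmetric in their two
targets. [folklore] -/
theorem stub_negCrossing :
    ∀ (t : unitInterval) (M N : ℕ),
      ((cornerPercolation t).map (BondConfig.relabel (sym2Equiv (Equiv.neg (Site 2))))).real
          (lrCrossing M N) = (cornerPercolation t).real (lrCrossing M N) ∧
        ((cornerPercolation t).map (BondConfig.relabel (sym2Equiv (Equiv.neg (Site 2))))).real
          (tbCrossing M N) = (cornerPercolation t).real (tbCrossing M N) := by
  intro t M N
  rw [map_measureReal_apply (MeasurableEquiv.measurable _) (measurableSet_lrCrossing M N),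
    map_measureReal_apply (MeasurableEquiv.measurable _) (measurableSet_tbCrossing M N),
    preimage_relabel_neg_lrCrossing, preimage_relabel_neg_tbCrossing,
    cornerPercolation_real_openCrossing_shift, cornerPercolation_real_openCrossing_shift,
    openCrossing_comm_aux _ (↑(rightSide M N) : Set (Site 2)),
    openCrossing_comm_aux _ (↑(topSide M N) : Set (Site 2))]
  exact ⟨rfl, rfl⟩

end Summit.CriticalPhenomena.CardyFormulaZ2.Cruxes.SegmentRSW.Birth

end
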